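import Mathlib
import Summits.NavierStokesRegularity.NavierStokesRegularity.Theorems.ThreadingFluxAzimuthalCartanHalfSpacePotential
import Summits.NavierStokesRegularity.NavierStokesRegularity.Theorems.ThreadingFluxAzimuthalCartanCrossFlowAxial
import HarnessLib

/-!
# Crux `PoloidalLiouville` (stmt-NavierStokesRegularity-1222, wall W1), crux idea «azimuthal-cartan-test» (ns-idea-15 g10):
# THE SECTORIAL CROSS FLOW `u_γ = crossFlow γ` — KINEMATICS on the half-space (derivative, `div u = 0`, `curl u`, `curl curl u`)

Support file (`--supports stmt-NavierStokesRegularity-1222`, helper; cell `ns-wall-extremal`, width hand ns-wall-eng-7 g7, 0 kit).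
For the Defs-twin field `crossFlow γ` (= `2γ F + G_γ(ρ) e₂` with the planar-harmonic `F` of `…HalfSpacePotential` and the axial profile
`G_γ = crossFlowAxial γ` of `…CrossFlowAxial`), at every point `x` with `0 < x₀` (notation: `a = x₀, b = x₁, s = a² + b² = ρ²`,
`φ = azimuth x`, `ℓ = log ρ`, `P = (a²−b²)(ℓ−1) + 2abφ`, `Q = 2ab(ℓ−1) − (a²−b²)φ`, `k = e^{−γℓ²}/s`):

* `crossFlow_eq` — `crossFlow γ y = (2γ c₀ y) e₀ + (2γ c₁ y) e₁ + G(ρ y) e₂` componentwise;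
* `hasFDerivAt_crossFlow`, `fderiv_crossFlow_apply_zero/one/two` — `Du(x)v = (2γ s⁻²(Pv₀ + Qv₁), 2γ s⁻²(Qv₀ − Pv₁), k(av₀ + bv₁))`;
* `divergence_crossFlow` — `div u = 0`; `curl_crossFlow` — `curl u (x) = k • (b, −a, 0)` (the azimuthal vorticity `−G′(ρ) e_φ`);
* `inner_self_curl_crossFlow` — `⟪x, curl u x⟫ = 0` (UNTHREADED about the origin, indeed about every point of the axis);
* `hasFDerivAt_vort`, `curl_vort` — for the vorticity field `w(y) = k(y) • (y₁, −y₀, 0)`: `curl w (x) = (2γ ℓ k) • e₂`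
  (the ODE of `G`: `k′ρ + 2k = −2γℓk`);
* `analyticAt_crossFlow`, `contDiffOn_crossFlow_ball`, `laplacian_crossFlow` — `Δu(x) = −(2γℓk) • e₂` by the LOCAL `Δ = −curl curl`
  of `…LocalCurlCurl` (no second derivatives of `u` computed).

HONEST FRAME: calculus on an explicit field; closes no crux or sketch Prop; `PoloidalLiouville` (1222) and NS regularity OPEN.
-/

-- the summit and its single sub-problem share the name (CONVENTIONS §1)
set_option linter.dupNamespace false

noncomputable section

namespace Summit.NavierStokesRegularity.NavierStokesRegularity.Theorems.PoloidalLiouville.AzimuthalCartan.CrossFlow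

open Set Function Filter Topology Metric
open scoped ContDiff RealInnerProductSpace
open Literature.Analysis.FluidPDE (curl divergence_eq_sum_inner_fderiv)
open Summit.NavierStokesRegularity.NavierStokesRegularity.Theorems.PoloidalLiouville.CentreJet (E3)
open Summit.NavierStokesRegularity.NavierStokesRegularity.Theorems.RotatingEulerWindowProfileLinearRung (hasFDerivAt_coord)
open Summit.NavierStokesRegularity.NavierStokesRegularity.Theorems.PoloidalLiouville.AzimuthalCartan.HalfSpace
open Summit.NavierStokesRegularity.NavierStokesRegularity.Theorems.PoloidalLiouville.AzimuthalCartan.Axial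

variable (γ : ℝ) {x : E3}

/-- `single i c = c • eᵢ`. -/
theorem single_eq_smul (i : Fin 3) (c : ℝ) :
    (EuclideanSpace.single i c : E3) = c • (EuclideanSpace.single i (1 : ℝ) : E3) := by
  ext j
  by_cases h : j = i
  · subst h; simp
  · simp [h]

/-- **The cross flow in the `eᵢ` frame**: `u = (2γ c₀) e₀ + (2γ c₁) e₁ + G(ρ) e₂`. -/
theorem crossFlow_eq :
    crossFlow γ = fun y : E3 =>
      (2 * γ * ((-(azimuth y) * y 1 - Real.log (cylRadius y) * y 0) / cylRadius y ^ 2)) • (EuclideanSpace.single 0 (1 : ℝ) : E3) +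
      (2 * γ * ((azimuth y * y 0 - Real.log (cylRadius y) * y 1) / cylRadius y ^ 2)) • (EuclideanSpace.single 1 (1 : ℝ) : E3) +
      (crossFlowAxial γ (cylRadius y)) • (EuclideanSpace.single 2 (1 : ℝ) : E3) := by
  funext y
  rw [crossFlow, single_eq_smul 0, single_eq_smul 1, single_eq_smul 2]
  congr 2 <;> ring

/-- Components of the cross flow. -/
theorem crossFlow_apply_zero (y : E3) :
    crossFlow γ y 0 = 2 * γ * ((-(azimuth y) * y 1 - Real.log (cylRadius y) * y 0) / cylRadius y ^ 2) := by
  rw [crossFlow_eq]; simp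

/-- Second component of the cross flow. -/
theorem crossFlow_apply_one (y : E3) :
    crossFlow γ y 1 = 2 * γ * ((azimuth y * y 0 - Real.log (cylRadius y) * y 1) / cylRadius y ^ 2) := by
  rw [crossFlow_eq]; simp

/-- Third component of the cross flow: the axial profile `G(ρ)`. -/
theorem crossFlow_apply_two (y : E3) : crossFlow γ y 2 = crossFlowAxial γ (cylRadius y) := by
  rw [crossFlow_eq]; simp

/-! ### The derivative of the cross flow -/

/-- The vertical component `G(ρ)` has derivative `(e^{−γℓ²}/s)(a dx₀ + b dx₁)`. -/
theorem hasFDerivAt_axial_comp (hx : 0 < x 0) :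
    HasFDerivAt (fun y : E3 => crossFlowAxial γ (cylRadius y))
      ((Real.exp (-(γ * Real.log (cylRadius x) ^ 2)) / (x 0 ^ 2 + x 1 ^ 2)) •
        ((x 0) • (EuclideanSpace.proj 0 : E3 →L[ℝ] ℝ) + (x 1) • (EuclideanSpace.proj 1 : E3 →L[ℝ] ℝ))) x := by
  have hρ := cylRadius_pos hx
  have h := (hasDerivAt_crossFlowAxial γ hρ).comp_hasFDerivAt x (hasFDerivAt_cylRadius hx)
  refine h.congr_fderiv ?_
  ext v
  simp only [smul_apply, add_apply, smul_eq_mul, proj_apply']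
  have hρ2 : cylRadius x ^ 2 = x 0 ^ 2 + x 1 ^ 2 := HalfSpace.cylRadius_sq x
  rw [← hρ2]
  field_simp

/-- **The derivative of the cross flow** (as a continuous linear map built from the three component covectors). -/
theorem hasFDerivAt_crossFlow (hx : 0 < x 0) :
    HasFDerivAt (crossFlow γ)
      (((2 * γ) • (((x 0 ^ 2 + x 1 ^ 2) ^ 2)⁻¹ •
          (((x 0 ^ 2 - x 1 ^ 2) * (Real.log (cylRadius x) - 1) + 2 * x 0 * x 1 * azimuth x) • (EuclideanSpace.proj 0 : E3 →L[ℝ] ℝ) +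
            (2 * x 0 * x 1 * (Real.log (cylRadius x) - 1) - (x 0 ^ 2 - x 1 ^ 2) * azimuth x) •
              (EuclideanSpace.proj 1 : E3 →L[ℝ] ℝ)))).smulRight (EuclideanSpace.single 0 (1 : ℝ) : E3) +
       ((2 * γ) • (((x 0 ^ 2 + x 1 ^ 2) ^ 2)⁻¹ •
          ((2 * x 0 * x 1 * (Real.log (cylRadius x) - 1) - (x 0 ^ 2 - x 1 ^ 2) * azimuth x) • (EuclideanSpace.proj 0 : E3 →L[ℝ] ℝ) -
            ((x 0 ^ 2 - x 1 ^ 2) * (Real.log (cylRadius x) - 1) + 2 * x 0 * x 1 * azimuth x) •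
              (EuclideanSpace.proj 1 : E3 →L[ℝ] ℝ)))).smulRight (EuclideanSpace.single 1 (1 : ℝ) : E3) +
       ((Real.exp (-(γ * Real.log (cylRadius x) ^ 2)) / (x 0 ^ 2 + x 1 ^ 2)) •
          ((x 0) • (EuclideanSpace.proj 0 : E3 →L[ℝ] ℝ) + (x 1) • (EuclideanSpace.proj 1 : E3 →L[ℝ] ℝ))).smulRight
            (EuclideanSpace.single 2 (1 : ℝ) : E3))
      x := by
  rw [crossFlow_eq]
  exact ((((hasFDerivAt_potComp0 hx).const_mul (2 * γ)).smul_const _).add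
    (((hasFDerivAt_potComp1 hx).const_mul (2 * γ)).smul_const _)).add ((hasFDerivAt_axial_comp γ hx).smul_const _)

/-- **`Du(x) v` in coordinates.** -/
theorem fderiv_crossFlow_apply (hx : 0 < x 0) (v : E3) :
    fderiv ℝ (crossFlow γ) x v =
      (2 * γ * (((x 0 ^ 2 + x 1 ^ 2) ^ 2)⁻¹ *
        (((x 0 ^ 2 - x 1 ^ 2) * (Real.log (cylRadius x) - 1) + 2 * x 0 * x 1 * azimuth x) * v 0 +
          (2 * x 0 * x 1 * (Real.log (cylRadius x) - 1) - (x 0 ^ 2 - x 1 ^ 2) * azimuth x) * v 1))) •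
          (EuclideanSpace.single 0 (1 : ℝ) : E3) +
      (2 * γ * (((x 0 ^ 2 + x 1 ^ 2) ^ 2)⁻¹ *
        ((2 * x 0 * x 1 * (Real.log (cylRadius x) - 1) - (x 0 ^ 2 - x 1 ^ 2) * azimuth x) * v 0 -
          ((x 0 ^ 2 - x 1 ^ 2) * (Real.log (cylRadius x) - 1) + 2 * x 0 * x 1 * azimuth x) * v 1))) •
          (EuclideanSpace.single 1 (1 : ℝ) : E3) +
      (Real.exp (-(γ * Real.log (cylRadius x) ^ 2)) / (x 0 ^ 2 + x 1 ^ 2) * (x 0 * v 0 + x 1 * v 1)) •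
          (EuclideanSpace.single 2 (1 : ℝ) : E3) := by
  rw [(hasFDerivAt_crossFlow γ hx).fderiv]
  simp only [add_apply, sub_apply, smul_apply, ContinuousLinearMap.smulRight_apply, smul_eq_mul, proj_apply']

/-- First coordinate of `Du(x) v`. -/
theorem fderiv_crossFlow_apply_zero (hx : 0 < x 0) (v : E3) :
    fderiv ℝ (crossFlow γ) x v 0 = 2 * γ * (((x 0 ^ 2 + x 1 ^ 2) ^ 2)⁻¹ *
        (((x 0 ^ 2 - x 1 ^ 2) * (Real.log (cylRadius x) - 1) + 2 * x 0 * x 1 * azimuth x) * v 0 +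
          (2 * x 0 * x 1 * (Real.log (cylRadius x) - 1) - (x 0 ^ 2 - x 1 ^ 2) * azimuth x) * v 1)) := by
  rw [fderiv_crossFlow_apply γ hx v]; simp

/-- Second coordinate of `Du(x) v`. -/
theorem fderiv_crossFlow_apply_one (hx : 0 < x 0) (v : E3) :
    fderiv ℝ (crossFlow γ) x v 1 = 2 * γ * (((x 0 ^ 2 + x 1 ^ 2) ^ 2)⁻¹ *
        ((2 * x 0 * x 1 * (Real.log (cylRadius x) - 1) - (x 0 ^ 2 - x 1 ^ 2) * azimuth x) * v 0 -
          ((x 0 ^ 2 - x 1 ^ 2) * (Real.log (cylRadius x) - 1) + 2 * x 0 * x 1 * azimuth x) * v 1)) := by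
  rw [fderiv_crossFlow_apply γ hx v]; simp

/-- Third coordinate of `Du(x) v`. -/
theorem fderiv_crossFlow_apply_two (hx : 0 < x 0) (v : E3) :
    fderiv ℝ (crossFlow γ) x v 2 = Real.exp (-(γ * Real.log (cylRadius x) ^ 2)) / (x 0 ^ 2 + x 1 ^ 2) * (x 0 * v 0 + x 1 * v 1) := by
  rw [fderiv_crossFlow_apply γ hx v]; simp

/-! ### Divergence and curl -/

/-- **`div u = 0`.** -/
theorem divergence_crossFlow (hx : 0 < x 0) : Literature.Analysis.FluidPDE.VectorCalculus.divergence (crossFlow γ) x = 0 := by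
  rw [divergence_eq_sum_inner_fderiv (EuclideanSpace.basisFun (Fin 3) ℝ)]
  simp only [Fin.sum_univ_three, EuclideanSpace.basisFun_apply, EuclideanSpace.inner_single_left, map_one, one_mul]
  rw [fderiv_crossFlow_apply_zero γ hx, fderiv_crossFlow_apply_one γ hx, fderiv_crossFlow_apply_two γ hx]
  simp
  ring

/-- **`curl u (x) = k • (x₁, −x₀, 0)`**, `k = e^{−γ log²ρ}/ρ²` — the azimuthal vorticity `−G′(ρ) e_φ`. -/
theorem curl_crossFlow (hx : 0 < x 0) :
    curl (crossFlow γ) x =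
      (Real.exp (-(γ * Real.log (cylRadius x) ^ 2)) / (x 0 ^ 2 + x 1 ^ 2) * x 1) • (EuclideanSpace.single 0 (1 : ℝ) : E3) +
      (-(Real.exp (-(γ * Real.log (cylRadius x) ^ 2)) / (x 0 ^ 2 + x 1 ^ 2) * x 0)) • (EuclideanSpace.single 1 (1 : ℝ) : E3) := by
  have h0 := fun v => fderiv_crossFlow_apply_zero γ hx v
  have h1 := fun v => fderiv_crossFlow_apply_one γ hx v
  have h2 := fun v => fderiv_crossFlow_apply_two γ hx v
  ext i
  fin_cases i <;> simp [curl, h0, h1, h2]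

/-- **The cross flow is UNTHREADED about the origin**: `⟪x, curl u x⟫ = 0`. -/
theorem inner_self_curl_crossFlow (hx : 0 < x 0) : ⟪x - 0, curl (crossFlow γ) x⟫ = 0 := by
  rw [sub_zero, curl_crossFlow γ hx, inner_add_right, inner_smul_right, inner_smul_right, EuclideanSpace.inner_single_right,
    EuclideanSpace.inner_single_right]
  simp
  ring

/-! ### The vorticity field `w(y) = k(y) • (y₁, −y₀, 0)` and its curl -/

/-- Derivative of the scalar `k(y) = e^{−γ log²ρ}/(y₀² + y₁²)`: `Dk = −k(2γ log ρ + 2)/s · (a dx₀ + b dx₁)`. -/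
theorem hasFDerivAt_vortScalar (hx : 0 < x 0) :
    HasFDerivAt (fun y : E3 => Real.exp (-(γ * Real.log (cylRadius y) ^ 2)) / (y 0 ^ 2 + y 1 ^ 2))
      ((-(Real.exp (-(γ * Real.log (cylRadius x) ^ 2)) / (x 0 ^ 2 + x 1 ^ 2)) * (2 * γ * Real.log (cylRadius x) + 2) /
          (x 0 ^ 2 + x 1 ^ 2)) • ((x 0) • (EuclideanSpace.proj 0 : E3 →L[ℝ] ℝ) + (x 1) • (EuclideanSpace.proj 1 : E3 →L[ℝ] ℝ)))
      x := by
  have hs := cylSq_pos hx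
  have hin : HasFDerivAt (fun y : E3 => -(γ * Real.log (cylRadius y) ^ 2))
      (-(γ • ((2 * Real.log (cylRadius x)) • ((x 0 ^ 2 + x 1 ^ 2)⁻¹ •
        ((x 0) • (EuclideanSpace.proj 0 : E3 →L[ℝ] ℝ) + (x 1) • (EuclideanSpace.proj 1 : E3 →L[ℝ] ℝ)))))) x := by
    have h := ((hasFDerivAt_logCyl hx).pow 2).const_mul γ
    refine (h.neg).congr_fderiv ?_ |>.congr_of_eventuallyEq (Eventually.of_forall fun y => by simp)
    ext v
    simp
  have hexp := hin.exp
  have h := hasFDerivAt_div hexp (hasFDerivAt_cylSq x) hs.ne'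
  refine h.congr_fderiv ?_
  ext v
  simp only [add_apply, sub_apply, smul_apply, neg_apply, smul_eq_mul, proj_apply']
  field_simp
  ring

/-- **The curl of the vorticity field**: for `w(y) = k(y) • (y₁, −y₀, 0)`, `curl w (x) = (2γ log ρ · k) • e₂`. -/
theorem curl_vort {w : E3 → E3}
    (hw : w = fun y : E3 =>
      (Real.exp (-(γ * Real.log (cylRadius y) ^ 2)) / (y 0 ^ 2 + y 1 ^ 2) * y 1) • (EuclideanSpace.single 0 (1 : ℝ) : E3) +
      (-(Real.exp (-(γ * Real.log (cylRadius y) ^ 2)) / (y 0 ^ 2 + y 1 ^ 2) * y 0)) • (EuclideanSpace.single 1 (1 : ℝ) : E3))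
    (hx : 0 < x 0) :
    curl w x = (2 * γ * Real.log (cylRadius x) * (Real.exp (-(γ * Real.log (cylRadius x) ^ 2)) / (x 0 ^ 2 + x 1 ^ 2))) •
      (EuclideanSpace.single 2 (1 : ℝ) : E3) := by
  have hs := cylSq_pos hx
  have hk := hasFDerivAt_vortScalar γ hx
  have hD : HasFDerivAt w
      (((Real.exp (-(γ * Real.log (cylRadius x) ^ 2)) / (x 0 ^ 2 + x 1 ^ 2)) • (EuclideanSpace.proj 1 : E3 →L[ℝ] ℝ) + (x 1) • ((-(Real.exp (-(γ * Real.log (cylRadius x) ^ 2)) / (x 0 ^ 2 + x 1 ^ 2)) * (2 * γ * Real.log (cylRadius x) + 2) / (x 0 ^ 2 + x 1 ^ 2)) • ((x 0) • (EuclideanSpace.proj 0 : E3 →L[ℝ] ℝ) + (x 1) • (EuclideanSpace.proj 1 : E3 →L[ℝ] ℝ)))).smulRight (EuclideanSpace.single 0 (1 : ℝ) : E3) +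
        (-((Real.exp (-(γ * Real.log (cylRadius x) ^ 2)) / (x 0 ^ 2 + x 1 ^ 2)) • (EuclideanSpace.proj 0 : E3 →L[ℝ] ℝ) + (x 0) • ((-(Real.exp (-(γ * Real.log (cylRadius x) ^ 2)) / (x 0 ^ 2 + x 1 ^ 2)) * (2 * γ * Real.log (cylRadius x) + 2) / (x 0 ^ 2 + x 1 ^ 2)) • ((x 0) • (EuclideanSpace.proj 0 : E3 →L[ℝ] ℝ) + (x 1) • (EuclideanSpace.proj 1 : E3 →L[ℝ] ℝ))))).smulRight (EuclideanSpace.single 1 (1 : ℝ) : E3)) x := by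
    rw [hw]
    exact ((hk.mul (hasFDerivAt_coord 1 x)).smul_const _).add ((hk.mul (hasFDerivAt_coord 0 x)).neg.smul_const _)
  have h0 : ∀ v : E3, fderiv ℝ w x v 0 = (Real.exp (-(γ * Real.log (cylRadius x) ^ 2)) / (x 0 ^ 2 + x 1 ^ 2)) * v 1 + x 1 * ((-(Real.exp (-(γ * Real.log (cylRadius x) ^ 2)) / (x 0 ^ 2 + x 1 ^ 2)) * (2 * γ * Real.log (cylRadius x) + 2) / (x 0 ^ 2 + x 1 ^ 2)) * (x 0 * v 0 + x 1 * v 1)) := fun v => by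
    rw [hD.fderiv]
    simp
    ring
  have h1 : ∀ v : E3, fderiv ℝ w x v 1 = -((Real.exp (-(γ * Real.log (cylRadius x) ^ 2)) / (x 0 ^ 2 + x 1 ^ 2)) * v 0 + x 0 * ((-(Real.exp (-(γ * Real.log (cylRadius x) ^ 2)) / (x 0 ^ 2 + x 1 ^ 2)) * (2 * γ * Real.log (cylRadius x) + 2) / (x 0 ^ 2 + x 1 ^ 2)) * (x 0 * v 0 + x 1 * v 1))) := fun v => by
    rw [hD.fderiv]
    simp
    ring
  have h2 : ∀ v : E3, fderiv ℝ w x v 2 = 0 := fun v => by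
    rw [hD.fderiv]
    simp
  ext i
  fin_cases i
  · simp [curl, h0, h1, h2]
  · simp [curl, h0, h1, h2]
  · simp [curl, h0, h1, h2]
    field_simp
    ring

end Summit.NavierStokesRegularity.NavierStokesRegularity.Theorems.PoloidalLiouville.AzimuthalCartan.CrossFlow

end
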